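import Summits.ValiantsHypothesis.ValiantsHypothesis.Theorems.KPlusLogSqLawStaticPathMixedEventsTips

/-!
# Route «KPlusLogSqLaw» — parametric max-weight independent set on a path: THEOREM T′, the λ-LOW TIPS of a corridor (uniqueness and existence)

HONEST FRAMING.  Helper toward the crux `WeakLifting` (item `stmt-ValiantsHypothesis-19561`, route `KPlusLogSqLaw`, cell `pub-symmetroid`,
seat val-sym-lift-p4 g21, 2026-08-29) on the line of its witness-plan stub `stub_tridiagonalSectorB` (tropical twin of the STATIC tridiagonal
sector = parametric maximum-weight independent set on a path).  Geometry of THEOREM T′ (THEOREM-T.md §4, val-sym-lift-p4 g14, «the cut lemma,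
every direction»): for a generic slope threshold `λ`, the λ-LOW TIP of an index window `[i, j]` is the pair of lines of the window at whose vertex the
functional `y - λθ` is minimised over the closed corridor of the window (below its even lines, above its odd lines): it is a pair of ODD lines whose
slopes STRADDLE `λ` (a bottom corner), or a (ceiling, floor) pair with the floor flatter and of slope `> λ` (a left tip), or with the ceiling flatter
and the floor of slope `< λ` (a right tip) — the predicate `S` below, taken as a hypothesis `hS` so that statements stay short.  In the sign language
of `…StaticPathMixedEventsTips` (no convexity library): (1) `lowTip_phi_le` — at a λ-type pair's vertex the functional is at most its value at any
point weakly on the correct side of the pair's two lines, with equality only at the vertex; hence (2) `lowTip_unique` — a window has at most one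
λ-low tip (hypothesis (U) of the signed counting lemma `…StaticPathSignedTipCount.signed_card_le_of_unique_tips`).  The existence half (hypothesis
(B): `lowTip_between`) follows in `…StaticPathLowTipsSteps` / `…StaticPathLowTipsBetween`.  Statements about a labelled line arrangement; nothing here asserts anything about `WeakLifting`, `TropicalB`,
`KPlusLogSqLaw`, the stub in its window, `MatrixDescartes` (stmt-ValiantsHypothesis-18050) or `VP ≠ VNP`.
-/

set_option linter.dupNamespace false
set_option autoImplicit false

namespace Summit.ValiantsHypothesis.ValiantsHypothesis.Theorems.KPlusLogSqLaw

open Finset Classical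

namespace StaticPathFold

noncomputable section

variable (a b : ℕ → ℝ)

/-! ## 1. The functional `y - λ θ` is dominated from below at a λ-type vertex -/

/-- point–slope form of a line around a parameter `τ`. [folklore] -/
theorem L_eq_L_add_mul (u : ℕ) (τ θ : ℝ) : L a b u θ = L a b u τ + a u * (θ - τ) := by
  unfold L; ring

/-- type I (two floors whose slopes straddle `λ`): any point weakly above both floors has functional value at least that of their vertex,
with equality only at the vertex. [folklore] -/
theorem phi_le_of_straddle (lam : ℝ) {o₁ o₂ : ℕ} (h1 : a o₁ < lam) (h2 : lam < a o₂) {τ y θ' y' : ℝ}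
    (hy1 : y = L a b o₁ τ) (hy2 : y = L a b o₂ τ) (hc1 : L a b o₁ θ' ≤ y') (hc2 : L a b o₂ θ' ≤ y') :
    y - lam * τ ≤ y' - lam * θ' ∧ (y' - lam * θ' ≤ y - lam * τ → θ' = τ ∧ y' = y) := by
  have e1 := L_eq_L_add_mul a b o₁ τ θ'
  have e2 := L_eq_L_add_mul a b o₂ τ θ'
  rcases lt_trichotomy θ' τ with hlt | heq | hgt
  · have : 0 < (a o₁ - lam) * (θ' - τ) := mul_pos_of_neg_of_neg (by linarith) (by linarith)
    constructor
    · nlinarith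
    · intro h; nlinarith
  · subst heq
    constructor
    · linarith
    · intro h; exact ⟨rfl, by linarith⟩
  · have : 0 < (a o₂ - lam) * (θ' - τ) := mul_pos (by linarith) (by linarith)
    constructor
    · nlinarith
    · intro h; nlinarith

/-- type II (ceiling `e`, floor `o` flatter, floor slope `> λ`): any point weakly between the two lines has functional value at least that of
their vertex, with equality only at the vertex. [folklore] -/
theorem phi_le_of_leftType (lam : ℝ) {e o : ℕ} (hs : a o < a e) (hl : lam < a o) {τ y θ' y' : ℝ}
    (hτ : τ = (b o - b e) / (a e - a o)) (hy : y = L a b o τ) (hce : y' ≤ L a b e θ') (hco : L a b o θ' ≤ y') :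
    y - lam * τ ≤ y' - lam * θ' ∧ (y' - lam * θ' ≤ y - lam * τ → θ' = τ ∧ y' = y) := by
  -- the point is weakly to the right of the vertex
  have hθ : τ ≤ θ' := by rw [hτ, ← crossAbs_symm a b o e]; exact (L_le_L_iff_crossAbs_le a b hs θ').mp (hco.trans hce)
  have e2 := L_eq_L_add_mul a b o τ θ'
  have h0 : 0 ≤ (a o - lam) * (θ' - τ) := mul_nonneg (by linarith) (by linarith)
  constructor
  · nlinarith
  · intro h
    have h3 : (a o - lam) * (θ' - τ) = 0 := by nlinarith
    rcases mul_eq_zero.mp h3 with h4 | h4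
    · exact absurd h4 (by linarith)
    · have : θ' = τ := by linarith
      subst this
      exact ⟨rfl, by nlinarith⟩

/-- type III (ceiling `e` flatter than the floor `o`, floor slope `< λ`): any point weakly between the two lines has functional value at least that
of their vertex, with equality only at the vertex. [folklore] -/
theorem phi_le_of_rightType (lam : ℝ) {e o : ℕ} (hs : a e < a o) (hl : a o < lam) {τ y θ' y' : ℝ}
    (hτ : τ = (b o - b e) / (a e - a o)) (hy : y = L a b o τ) (hce : y' ≤ L a b e θ') (hco : L a b o θ' ≤ y') :
    y - lam * τ ≤ y' - lam * θ' ∧ (y' - lam * θ' ≤ y - lam * τ → θ' = τ ∧ y' = y) := by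
  -- the point is weakly to the left of the vertex
  have hθ : θ' ≤ τ := by rw [hτ]; exact (L_le_L_iff_le_crossAbs a b hs θ').mp (hco.trans hce)
  have e2 := L_eq_L_add_mul a b o τ θ'
  have h0 : 0 ≤ (a o - lam) * (θ' - τ) := mul_nonneg_of_nonpos_of_nonpos (by linarith) (by linarith)
  constructor
  · nlinarith
  · intro h
    have h3 : (a o - lam) * (θ' - τ) = 0 := by nlinarith
    rcases mul_eq_zero.mp h3 with h4 | h4
    · exact absurd h4 (by linarith)
    · have : θ' = τ := by linarith
      subst this
      exact ⟨rfl, by nlinarith⟩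

/-! ## 2. λ-type pairs: the dispatcher, and uniqueness of the λ-low tip of a window -/

section LowTips

variable (lam : ℝ) (S : ℕ → ℕ → Prop)

/-- **the functional is minimised at a λ-type vertex over the weak wedge of its two lines**: for a λ-type pair `(p, q)` (`hS`: two floors whose
slopes straddle `λ` / ceiling–floor with the floor flatter and of slope `> λ` / ceiling flatter and floor slope `< λ`) and any point `(θ', y')`
weakly on the correct side of both lines (below if even, above if odd), `L p τ - λ τ ≤ y' - λ θ'` (`τ` the crossing abscissa), with equality only
at the vertex. [folklore] -/
theorem phi_le_of_lowType
    (hS : ∀ p q, S p q ↔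
      ((¬ Even p ∧ ¬ Even q ∧ ((a p < lam ∧ lam < a q) ∨ (a q < lam ∧ lam < a p))) ∨
       (Odd (p + q) ∧ (if Even p then a q < a p else a p < a q) ∧ lam < (if Even p then a q else a p)) ∨
       (Odd (p + q) ∧ (if Even p then a p < a q else a q < a p) ∧ (if Even p then a q else a p) < lam)))
    {p q : ℕ} (hpq : S p q) {θ' y' : ℝ}
    (wp : (Even p → y' ≤ L a b p θ') ∧ (¬ Even p → L a b p θ' ≤ y'))
    (wq : (Even q → y' ≤ L a b q θ') ∧ (¬ Even q → L a b q θ' ≤ y')) :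
    L a b p ((b q - b p) / (a p - a q)) - lam * ((b q - b p) / (a p - a q)) ≤ y' - lam * θ' ∧
      (y' - lam * θ' ≤ L a b p ((b q - b p) / (a p - a q)) - lam * ((b q - b p) / (a p - a q)) →
        θ' = (b q - b p) / (a p - a q) ∧ y' = L a b p ((b q - b p) / (a p - a q))) := by
  set τ := (b q - b p) / (a p - a q) with hτ
  rcases (hS p q).mp hpq with ⟨hpo, hqo, hstr⟩ | ⟨hodd, hs, hl⟩ | ⟨hodd, hs, hl⟩
  · -- type I
    rcases hstr with ⟨h1, h2⟩ | ⟨h1, h2⟩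
    · have hA : a p ≠ a q := ne_of_lt (h1.trans h2)
      exact phi_le_of_straddle a b lam h1 h2 rfl (L_eq_L_crossAbs a b hA).symm (wp.2 hpo) (wq.2 hqo)
    · have hA : a p ≠ a q := (ne_of_lt (h1.trans h2)).symm
      have h := phi_le_of_straddle a b lam h1 h2 (y := L a b p τ) (τ := τ) (L_eq_L_crossAbs a b hA).symm rfl (wq.2 hqo) (wp.2 hpo)
      exact h
  · -- type II: left tips
    by_cases hpe : Even p
    · rw [if_pos hpe] at hs hl
      have hqo : ¬ Even q := fun h => by rw [Nat.odd_add'] at hodd; exact (Nat.not_even_iff_odd.mpr (hodd.mpr hpe)) h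
      have hA : a p ≠ a q := (ne_of_lt hs).symm
      have h := phi_le_of_leftType a b lam hs hl (τ := τ) (y := L a b p τ) (by rw [hτ])
        (L_eq_L_crossAbs a b hA).symm (wp.1 hpe) (wq.2 hqo)
      exact h
    · rw [if_neg hpe] at hs hl
      have hqe : Even q := by rw [Nat.odd_add] at hodd; exact hodd.mp (Nat.not_even_iff_odd.mp hpe)
      have h := phi_le_of_leftType a b lam hs hl (τ := τ) (y := L a b p τ) (by rw [hτ, crossAbs_symm]) rfl (wq.1 hqe) (wp.2 hpe)
      exact h
  · -- type III: right tips
    by_cases hpe : Even p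
    · rw [if_pos hpe] at hs hl
      have hqo : ¬ Even q := fun h => by rw [Nat.odd_add'] at hodd; exact (Nat.not_even_iff_odd.mpr (hodd.mpr hpe)) h
      have hA : a p ≠ a q := ne_of_lt hs
      have h := phi_le_of_rightType a b lam hs hl (τ := τ) (y := L a b p τ) (by rw [hτ])
        (L_eq_L_crossAbs a b hA).symm (wp.1 hpe) (wq.2 hqo)
      exact h
    · rw [if_neg hpe] at hs hl
      have hqe : Even q := by rw [Nat.odd_add] at hodd; exact hodd.mp (Nat.not_even_iff_odd.mp hpe)
      have h := phi_le_of_rightType a b lam hs hl (τ := τ) (y := L a b p τ) (by rw [hτ, crossAbs_symm]) rfl (wq.1 hqe) (wp.2 hpe)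
      exact h

/-- strict correctness (positive `gap`) implies weak correctness. [folklore] -/
theorem weak_of_gap_pos {t : ℕ} {y z : ℝ} (h : 0 < gap t y z) : (Even t → y ≤ z) ∧ (¬ Even t → z ≤ y) := by
  unfold gap at h
  constructor
  · intro he; rw [if_pos he] at h; linarith
  · intro ho; rw [if_neg ho] at h; linarith

/-- a line through a point is not strictly correct there. [folklore] -/
theorem gap_self_not_pos (t : ℕ) (y : ℝ) : ¬ 0 < gap t y y := by
  unfold gap; split_ifs <;> simp

/-- **A WINDOW HAS AT MOST ONE λ-LOW TIP** (THEOREM-T.md §4, uniqueness; hypothesis (U) of the signed counting lemma): two λ-type pairs `p < q`,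
`p' < q'` of the window `[i, j]`, each with every other line of the window strictly on its correct side of its vertex, are equal — each vertex is
weakly on the correct side of the other pair, so the two functional values coincide, the vertices coincide, and a line strictly correct at a point
does not pass through it. [folklore] -/
theorem lowTip_unique
    (hS : ∀ p q, S p q ↔
      ((¬ Even p ∧ ¬ Even q ∧ ((a p < lam ∧ lam < a q) ∨ (a q < lam ∧ lam < a p))) ∨
       (Odd (p + q) ∧ (if Even p then a q < a p else a p < a q) ∧ lam < (if Even p then a q else a p)) ∨
       (Odd (p + q) ∧ (if Even p then a p < a q else a q < a p) ∧ (if Even p then a q else a p) < lam)))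
    (i j p q p' q' : ℕ)
    (hp : i ≤ p) (hpq : p < q) (hq : q ≤ j) (hSpq : S p q)
    (hG : ∀ t, i ≤ t → t ≤ j → t ≠ p → t ≠ q →
      0 < gap t (L a b p ((b q - b p) / (a p - a q))) (L a b t ((b q - b p) / (a p - a q))))
    (hp' : i ≤ p') (hpq' : p' < q') (hq' : q' ≤ j) (hSpq' : S p' q')
    (hG' : ∀ t, i ≤ t → t ≤ j → t ≠ p' → t ≠ q' →
      0 < gap t (L a b p' ((b q' - b p') / (a p' - a q'))) (L a b t ((b q' - b p') / (a p' - a q')))) :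
    p = p' ∧ q = q' := by
  set τ := (b q - b p) / (a p - a q) with hτ
  set τ' := (b q' - b p') / (a p' - a q') with hτ'
  set y := L a b p τ with hy
  set y' := L a b p' τ' with hy'
  -- slopes of a λ-type pair differ, so the two lines meet at the vertex
  have hA : ∀ u v, S u v → a u ≠ a v := by
    intro u v h
    rcases (hS u v).mp h with ⟨-, -, h⟩ | ⟨-, h, -⟩ | ⟨-, h, -⟩
    · rcases h with ⟨h1, h2⟩ | ⟨h1, h2⟩
      · exact ne_of_lt (h1.trans h2)
      · exact (ne_of_lt (h1.trans h2)).symm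
    · split_ifs at h
      · exact (ne_of_lt h).symm
      · exact ne_of_lt h
    · split_ifs at h
      · exact ne_of_lt h
      · exact (ne_of_lt h).symm
  have hyq : y = L a b q τ := by rw [hy, hτ]; exact (L_eq_L_crossAbs a b (hA p q hSpq)).symm
  have hyq' : y' = L a b q' τ' := by rw [hy', hτ']; exact (L_eq_L_crossAbs a b (hA p' q' hSpq')).symm
  -- weak correctness of each vertex with respect to the other pair
  have wk : ∀ t, i ≤ t → t ≤ j → (Even t → y' ≤ L a b t τ') ∧ (¬ Even t → L a b t τ' ≤ y') := by
    intro t ht1 ht2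
    by_cases htp : t = p'
    · subst htp; exact ⟨fun _ => le_of_eq hy', fun _ => le_of_eq hy'.symm⟩
    by_cases htq : t = q'
    · subst htq; exact ⟨fun _ => le_of_eq hyq', fun _ => le_of_eq hyq'.symm⟩
    exact weak_of_gap_pos (hG' t ht1 ht2 htp htq)
  have wk' : ∀ t, i ≤ t → t ≤ j → (Even t → y ≤ L a b t τ) ∧ (¬ Even t → L a b t τ ≤ y) := by
    intro t ht1 ht2
    by_cases htp : t = p
    · subst htp; exact ⟨fun _ => le_of_eq hy, fun _ => le_of_eq hy.symm⟩
    by_cases htq : t = q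
    · subst htq; exact ⟨fun _ => le_of_eq hyq, fun _ => le_of_eq hyq.symm⟩
    exact weak_of_gap_pos (hG t ht1 ht2 htp htq)
  have h1 := phi_le_of_lowType a b lam S hS hSpq (wk p hp (by omega)) (wk q (by omega) hq)
  have h2 := phi_le_of_lowType a b lam S hS hSpq' (wk' p' hp' (by omega)) (wk' q' (by omega) hq')
  -- the two functional values coincide, hence the vertices coincide
  obtain ⟨hθ, hyy⟩ := h1.2 h2.1
  -- `p` and `q` pass through the common vertex, so they are among `p', q'`
  have hmem : ∀ t, t = p ∨ t = q → t = p' ∨ t = q' := by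
    intro t ht
    by_contra hne
    push Not at hne
    have hti : i ≤ t := by rcases ht with ht | ht <;> omega
    have htj : t ≤ j := by rcases ht with ht | ht <;> omega
    have hg := hG' t hti htj hne.1 hne.2
    have hval : L a b t τ' = y' := by
      rcases ht with ht | ht
      · rw [ht, hyy, hθ]
      · rw [ht, hyy, hθ, ← hτ, ← hy]; exact hyq.symm
    rw [hval] at hg
    exact gap_self_not_pos t y' hg
  rcases hmem p (Or.inl rfl) with e1 | e1 <;> rcases hmem q (Or.inr rfl) with e2 | e2
  · omega
  · exact ⟨e1, e2⟩
  · omega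
  · omega

end LowTips

end

end StaticPathFold

end Summit.ValiantsHypothesis.ValiantsHypothesis.Theorems.KPlusLogSqLaw
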